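import Mathlib
import Summits.Ventures.PercRepro2.HCov
import Summits.Ventures.PercRepro2.HCovSwap
import Summits.Ventures.PercRepro2.RECMReduction
import Summits.Ventures.PercRepro2.CCWReduced
import Summits.Ventures.PercRepro2.PendantRoot
import Summits.Ventures.PercRepro2.PendantO
import Summits.Ventures.PercRepro2.PendantBRow
import Summits.Ventures.PercRepro2.SepZeroSep
import Summits.Ventures.PercRepro2.RootLeafA3
import Summits.Ventures.PercRepro2.RootLeafOTheorem
import Summits.Ventures.PercRepro2.RootLeafBTheorem
import Summits.Ventures.PercRepro2.GcSkelRules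
import Summits.Ventures.PercRepro2.GcSkelReduction

/-!
# The sharp weighted reduced class: every pendant mark hangs at an unmarked vertex
(blind cell PercRepro2, typer-1 g52)

On the weighted reduced class (`GcSkelReduction.lean`) the only leaves left are the marks
`a₁, a₂, a₃` (an unmarked leaf is deleted, an `o`- or `b`-leaf is moved). A pendant `a₃` at a
MARKED vertex and a pendant root at a MARKED vertex are landed theorems of the cell:

* `a₃` at a root — `PendantRoot.HCov_pendant_either_root`; at `o` — `PendantO.HCov_pendant_o`;
  at `b` — `PendantB.HCov_pendant_b`;
* a root at the other root — the (ONE-ROOT) zero `SepZero.Gc_eq_zero_of_root_leaf`; at `a₃` —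
  `RootLeafA3.HCov_root_leaf_a3` (and `'`); at `o` — `RootLeafO.HCov_root_leaf_o` (and `'`);
  at `b` — `RootLeafB.HCov_root_leaf_b` (and `'`).

**`WReducedS`** adds to `WReduced` that every pendant mark among `a₁, a₂, a₃` hangs at an UNMARKED
vertex (necessarily of non-loop degree `≥ 3`): the two open pendant attachments (G1) and (G4-u) of
S3.10. **`HCov_all_of_HCovWRedS_all`** / **`HCov_all_iff_HCovWRedS_all`**: (HCOV) for every finite
weighted graph is equivalent to (HCOV) on this class. No induction is needed beyond
`GcSkelReduction.lean`: the marked attachments are theorems, not reductions (after the loops at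
the leaf are relocated, `exists_relocated`).
-/

namespace Summit.Ventures.PercRepro2

open CovForm Contract RECM

namespace WRed

/-! ## The sharp class -/

section ClassS

variable {V : Type*} {E : Type*} [Fintype E] [DecidableEq E] [DecidableEq V]

/-- **The sharp weighted reduced class**: `WReduced`, and every pendant mark among `a₃, a₁, a₂`
hangs at an unmarked vertex. -/
structure WReducedS (ends : E → Sym2 V) (o a₁ a₂ a₃ b : V) : Prop
    extends WReduced ends o a₁ a₂ a₃ b where
  /-- a pendant `a₃` hangs at an unmarked vertex -/
  leaf_a3 : ∀ (e : E) (x : V), ends e = s(x, a₃) → x ≠ a₃ → nonLoopDeg ends a₃ = 1 →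
    Unmarked o a₁ a₂ a₃ b x
  /-- a pendant `a₁` hangs at an unmarked vertex -/
  leaf_a1 : ∀ (e : E) (x : V), ends e = s(x, a₁) → x ≠ a₁ → nonLoopDeg ends a₁ = 1 →
    Unmarked o a₁ a₂ a₃ b x
  /-- a pendant `a₂` hangs at an unmarked vertex -/
  leaf_a2 : ∀ (e : E) (x : V), ends e = s(x, a₂) → x ≠ a₂ → nonLoopDeg ends a₂ = 1 →
    Unmarked o a₁ a₂ a₃ b x

end ClassS

section Closure

variable (R : Type*) [Field R] [LinearOrder R] [IsStrictOrderedRing R]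

/-- **(HCOV) on the sharp weighted reduced class**. -/
def HCovWRedS_all : Prop :=
  ∀ (V E : Type) [Fintype V] [DecidableEq V] [Fintype E] [DecidableEq E]
    (ends : E → Sym2 V) (p : E → R), IsProbVec p →
    ∀ o a₁ a₂ a₃ b : V, a₁ ≠ a₂ → a₁ ≠ a₃ → a₂ ≠ a₃ → o ≠ a₁ → o ≠ a₂ → o ≠ a₃ → o ≠ b →
      b ≠ a₁ → b ≠ a₂ → b ≠ a₃ → WReducedS ends o a₁ a₂ a₃ b → HCov p ends o a₁ a₂ a₃ b

end Closure

/-! ## Pendant marks at marked vertices are theorems -/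

section Steps

variable {V : Type*} {E : Type*} [Fintype E] [DecidableEq E] [Fintype V] [DecidableEq V]
  {R : Type*} [Field R] [LinearOrder R] [IsStrictOrderedRing R]

/-- **A pendant `a₃` at a marked vertex**: (HCOV) holds outright (pendant-root / pendant-`o` /
pendant-`b` theorems, after the loops at `a₃` are relocated). -/
theorem HCov_of_a3_leaf_marked (ends : E → Sym2 V) (p : E → R) (hp : IsProbVec p)
    (o a₁ a₂ a₃ b : V) (h13 : a₁ ≠ a₃) (h23 : a₂ ≠ a₃) (ho3 : o ≠ a₃) (hb3 : b ≠ a₃)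
    (hd : nonLoopDeg ends a₃ = 1)
    (hmark : ∃ (e : E) (x : V), ends e = s(x, a₃) ∧ x ≠ a₃ ∧ ¬ Unmarked o a₁ a₂ a₃ b x) :
    HCov p ends o a₁ a₂ a₃ b := by
  obtain ⟨e₀, x₀, he₀, hx₀, hm⟩ := hmark
  obtain ⟨ends₁, e, x, h₁e, hx3, hleaf₁, hagree, hagree', he, huniq⟩ := exists_relocated hd
  obtain rfl : x₀ = x := eq_of_leaf_edge he hx3 huniq he₀ hx₀
  have hf₁ : ends₁ e = s(a₃, x₀) := by rw [h₁e, Sym2.eq_swap]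
  unfold HCov
  rw [Gc_eq_of_agree_nonLoop p hagree hagree' o a₁ a₂ a₃ b]
  by_cases hxo : x₀ = o
  · have hf' : ends₁ e = s(a₃, o) := by rw [← hxo]; exact hf₁
    exact PendantO.HCov_pendant_o p ends₁ hp hf' hleaf₁ ho3.symm h13.symm h23.symm hb3
  by_cases hx1 : x₀ = a₁
  · have hf' : ends₁ e = s(a₃, a₁) := by rw [← hx1]; exact hf₁
    exact PendantRoot.HCov_pendant_either_root p hp ends₁ hleaf₁ (Or.inr hf') h13.symm h23.symm
      ho3 hb3
  by_cases hx2 : x₀ = a₂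
  · have hf' : ends₁ e = s(a₃, a₂) := by rw [← hx2]; exact hf₁
    exact PendantRoot.HCov_pendant_either_root p hp ends₁ hleaf₁ (Or.inl hf') h13.symm h23.symm
      ho3 hb3
  by_cases hxb : x₀ = b
  · have hf' : ends₁ e = s(a₃, b) := by rw [← hxb]; exact hf₁
    exact PendantB.HCov_pendant_b p ends₁ hp hf' hleaf₁ hb3.symm h13.symm h23.symm ho3
  exact absurd ⟨hxo, hx1, hx2, hx3, hxb⟩ hm

/-- **A pendant `a₁` at a marked vertex**: (HCOV) holds outright (the (ONE-ROOT) zero at `a₂`,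
the root-leaf theorems at `a₃`, `o`, `b`). -/
theorem HCov_of_a1_leaf_marked (ends : E → Sym2 V) (p : E → R) (hp : IsProbVec p)
    (o a₁ a₂ a₃ b : V) (h12 : a₁ ≠ a₂) (h13 : a₁ ≠ a₃) (ho1 : o ≠ a₁) (hb1 : b ≠ a₁)
    (hd : nonLoopDeg ends a₁ = 1)
    (hmark : ∃ (e : E) (x : V), ends e = s(x, a₁) ∧ x ≠ a₁ ∧ ¬ Unmarked o a₁ a₂ a₃ b x) :
    HCov p ends o a₁ a₂ a₃ b := by
  obtain ⟨e₀, x₀, he₀, hx₀, hm⟩ := hmark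
  obtain ⟨ends₁, e, x, h₁e, hx1, hleaf₁, hagree, hagree', he, huniq⟩ := exists_relocated hd
  obtain rfl : x₀ = x := eq_of_leaf_edge he hx1 huniq he₀ hx₀
  have hf₁ : ends₁ e = s(a₁, x₀) := by rw [h₁e, Sym2.eq_swap]
  unfold HCov
  rw [Gc_eq_of_agree_nonLoop p hagree hagree' o a₁ a₂ a₃ b]
  by_cases hxo : x₀ = o
  · have hf' : ends₁ e = s(a₁, o) := by rw [← hxo]; exact hf₁
    exact RootLeafO.HCov_root_leaf_o p ends₁ hp hf' hleaf₁ ho1.symm h12 h13 hb1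
  by_cases hx2 : x₀ = a₂
  · rw [SepZero.Gc_eq_zero_of_root_leaf p ends₁ o a₁ a₂ a₃ b
      (fun g hg => by rw [hleaf₁ g hg, hf₁, hx2]) ho1.symm hb1.symm h13]
  by_cases hx3 : x₀ = a₃
  · have hf' : ends₁ e = s(a₁, a₃) := by rw [← hx3]; exact hf₁
    exact RootLeafA3.HCov_root_leaf_a3 p ends₁ hp hf' hleaf₁ h13 h12 ho1 hb1
  by_cases hxb : x₀ = b
  · have hf' : ends₁ e = s(a₁, b) := by rw [← hxb]; exact hf₁
    exact RootLeafB.HCov_root_leaf_b p ends₁ hp hf' hleaf₁ hb1.symm h12 h13 ho1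
  exact absurd ⟨hxo, hx1, hx2, hx3, hxb⟩ hm

/-- **A pendant `a₂` at a marked vertex**: (HCOV) holds outright (mirror of
`HCov_of_a1_leaf_marked` through the root symmetry). -/
theorem HCov_of_a2_leaf_marked (ends : E → Sym2 V) (p : E → R) (hp : IsProbVec p)
    (o a₁ a₂ a₃ b : V) (h12 : a₁ ≠ a₂) (h23 : a₂ ≠ a₃) (ho2 : o ≠ a₂) (hb2 : b ≠ a₂)
    (hd : nonLoopDeg ends a₂ = 1)
    (hmark : ∃ (e : E) (x : V), ends e = s(x, a₂) ∧ x ≠ a₂ ∧ ¬ Unmarked o a₁ a₂ a₃ b x) :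
    HCov p ends o a₁ a₂ a₃ b := by
  obtain ⟨e₀, x₀, he₀, hx₀, hm⟩ := hmark
  obtain ⟨ends₁, e, x, h₁e, hx2, hleaf₁, hagree, hagree', he, huniq⟩ := exists_relocated hd
  obtain rfl : x₀ = x := eq_of_leaf_edge he hx2 huniq he₀ hx₀
  have hf₁ : ends₁ e = s(a₂, x₀) := by rw [h₁e, Sym2.eq_swap]
  unfold HCov
  rw [Gc_eq_of_agree_nonLoop p hagree hagree' o a₁ a₂ a₃ b]
  by_cases hxo : x₀ = o
  · have hf' : ends₁ e = s(a₂, o) := by rw [← hxo]; exact hf₁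
    exact RootLeafO.HCov_root_leaf_o' p ends₁ hp hf' hleaf₁ ho2.symm h12.symm h23 hb2
  by_cases hx1 : x₀ = a₁
  · rw [← Gc_swap p ends₁ o a₁ a₂ a₃ b, SepZero.Gc_eq_zero_of_root_leaf p ends₁ o a₂ a₁ a₃ b
      (fun g hg => by rw [hleaf₁ g hg, hf₁, hx1]) ho2.symm hb2.symm h23]
  by_cases hx3 : x₀ = a₃
  · have hf' : ends₁ e = s(a₂, a₃) := by rw [← hx3]; exact hf₁
    exact RootLeafA3.HCov_root_leaf_a3' p ends₁ hp hf' hleaf₁ h23 h12.symm ho2 hb2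
  by_cases hxb : x₀ = b
  · have hf' : ends₁ e = s(a₂, b) := by rw [← hxb]; exact hf₁
    exact RootLeafB.HCov_root_leaf_b' p ends₁ hp hf' hleaf₁ hb2.symm h12.symm h23 ho2
  exact absurd ⟨hxo, hx1, hx2, hx3, hxb⟩ hm

end Steps

/-! ## The sharp reduction -/

section Main

variable {R : Type*} [Field R] [LinearOrder R] [IsStrictOrderedRing R]

/-- (HCOV) on the weighted reduced class follows from (HCOV) on the sharp class: a pendant mark at
a marked vertex is a theorem, else the instance is in `WReducedS`. -/
theorem HCovWRed_all_of_HCovWRedS_all (hB : HCovWRedS_all R) : HCovWRed_all R := by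
  intro V E _ _ _ _ ends p hp o a₁ a₂ a₃ b h12 h13 h23 ho1 ho2 ho3 hob hb1 hb2 hb3 hred
  by_cases h3 : ∃ (e : E) (x : V), ends e = s(x, a₃) ∧ x ≠ a₃ ∧ nonLoopDeg ends a₃ = 1 ∧
      ¬ Unmarked o a₁ a₂ a₃ b x
  · obtain ⟨e, x, he, hx, hd, hm⟩ := h3
    exact HCov_of_a3_leaf_marked ends p hp o a₁ a₂ a₃ b h13 h23 ho3 hb3 hd ⟨e, x, he, hx, hm⟩
  by_cases h1 : ∃ (e : E) (x : V), ends e = s(x, a₁) ∧ x ≠ a₁ ∧ nonLoopDeg ends a₁ = 1 ∧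
      ¬ Unmarked o a₁ a₂ a₃ b x
  · obtain ⟨e, x, he, hx, hd, hm⟩ := h1
    exact HCov_of_a1_leaf_marked ends p hp o a₁ a₂ a₃ b h12 h13 ho1 hb1 hd ⟨e, x, he, hx, hm⟩
  by_cases h2 : ∃ (e : E) (x : V), ends e = s(x, a₂) ∧ x ≠ a₂ ∧ nonLoopDeg ends a₂ = 1 ∧
      ¬ Unmarked o a₁ a₂ a₃ b x
  · obtain ⟨e, x, he, hx, hd, hm⟩ := h2
    exact HCov_of_a2_leaf_marked ends p hp o a₁ a₂ a₃ b h12 h23 ho2 hb2 hd ⟨e, x, he, hx, hm⟩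
  push Not at h3 h1 h2
  exact hB V E ends p hp o a₁ a₂ a₃ b h12 h13 h23 ho1 ho2 ho3 hob hb1 hb2 hb3 ⟨hred, h3, h1, h2⟩

/-- **THE SHARP WEIGHTED REDUCED-CLASS THEOREM**: (HCOV) for every finite weighted graph with five
distinct marks follows from (HCOV) on the simple graphs whose unmarked vertices have non-loop
degree `0` or `≥ 3`, whose `o`, `b` are not leaves, and whose pendant marks `a₁, a₂, a₃` hang at
unmarked vertices. -/
theorem HCov_all_of_HCovWRedS_all (hB : HCovWRedS_all R) : HCov_all R :=
  HCov_all_of_HCovWRed_all (HCovWRed_all_of_HCovWRedS_all hB)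

/-- The sharp class is a faithful reduction: `HCov_all ↔ HCovWRedS_all`. -/
theorem HCov_all_iff_HCovWRedS_all : HCov_all R ↔ HCovWRedS_all R :=
  ⟨fun h V E _ _ _ _ ends p hp o a₁ a₂ a₃ b h12 h13 h23 ho1 ho2 ho3 hob hb1 hb2 hb3 _ =>
    h V E ends p hp o a₁ a₂ a₃ b h12 h13 h23 ho1 ho2 ho3 hob hb1 hb2 hb3,
   HCov_all_of_HCovWRedS_all⟩

end Main

end WRed

end Summit.Ventures.PercRepro2
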